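import Summits.ValiantsHypothesis.ValiantsHypothesis.Theorems.BarrierLeverPartitionMinorsHitByVPJointPeelHit

/-!
# Route BarrierLever — item `PartitionMinorsHitByVP` (stmt-ValiantsHypothesis-19717):
# joint peeling with the RADIUS-ONE BASE — rows of size `≤ 1` are universal leaves

Helper file (`--supports stmt-ValiantsHypothesis-19717`; cell valiant-natproofs, rung V4, 𝒟-side door (c); prover
seat val-np-p6 gen 6). One inductive predicate (`JointlyPeelable₂` = `JointlyPeelable` of `…JointPeelClass` with a
fourth constructor) and its theorems. Closes NO item.

THE NEW LEAF. If every row set has at most one element (`R ⊆ B(n,1)`, any sub-family) and the column weights are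
distinct, the Moore matrix is nonsingular: the substitution `Y_last ↦ Z_∅`, `Y_a ↦ Z_{a} − Z_∅` turns the node forms into
distinct indeterminates, and a generalized Vandermonde in distinct indeterminates with distinct exponents is nonzero
(`det_X_pow_ne_zero`, val-np-p6 g5). This is the `e ≤ 1` theorem of `…HitByVPMooreBall` freed from «all of `B(h,1)`» and
from the ball exponents. As a LEAF of the joint peel it matters: the recursion can stop as soon as the rows have radius
`≤ 1`, however many columns remain — seat census (lab/jp_free2.py): with this leaf, a free digit order and the `x ↔ y`
mirror, 2 383 / 2 591 labelled lower-set pairs at `h = 4` (92 %) and 543 / 600 random lower-set pairs at `h = 5` are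
certified (62 % / 47 % without the leaf); e.g. the co-rank-4 cross pair (rows: all but `univ` and three co-atoms; columns:
all but an interval `[univ ∖ {0,1}, univ]`) peels down to `({∅,a,b,c}, {∅,0,1,01})`, a radius-one leaf.

* `colMatrix_det_ne_zero_of_radius_le_one` — the leaf;
* `JointlyPeelable₂` (`small` / `radiusOne` / `peel` / `relabel`), `colMatrix_det_ne_zero_of_jointlyPeelable₂`,
  **`partitionMinor_hit_of_jointlyPeelable₂`** (h ≥ 2, SmallCircuits ℂ (h+h) 5).

WHAT THIS IS NOT: a certificate format; which pairs admit certificates is combinatorial (not all: 8 % of the lower-set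
pairs at `h = 4` do not, in either orientation); nothing on crux 14610 or VP vs VNP.
-/

set_option linter.dupNamespace false

namespace Summit.ValiantsHypothesis.ValiantsHypothesis.Theorems.BarrierLever.FrobeniusDoor

open Finset MvPolynomial Matrix
open Literature.Barriers.ValiantsHypothesis

noncomputable section

variable (p : ℕ) [Fact p.Prime]

/-- **Radius-one leaf.** Rows of size `≤ 1` (any sub-family of `B(n,1)`) and pairwise distinct column weights: the Moore
matrix `colMatrix` is nonsingular (every prime `p`). -/
theorem colMatrix_det_ne_zero_of_radius_le_one (n k : ℕ) (d : Fin k → ℕ) (R : Finset (Finset (Fin n)))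
    (hR : ∀ S ∈ R, S.card ≤ 1) (W : Fam R → Finset (Fin k))
    (hW : Function.Injective fun T => ballWt p k d (W T)) : (colMatrix p n k d R W).det ≠ 0 := by
  classical
  set N := Fintype.card (Fam R) with hN
  set e : Fam R ≃ Fin N := Fintype.equivFin (Fam R) with he
  -- the substitution: `Y_last ↦ Z_∅` (or `0`), `Y_a ↦ Z_{a} − Z_∅` (or `0`)
  let g0 : MvPolynomial (Fin N) (ZMod p) := if h0 : (∅ : Finset (Fin n)) ∈ R then X (e ⟨∅, h0⟩) else 0
  let g : Fin (n + 1) → MvPolynomial (Fin N) (ZMod p) :=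
    Fin.lastCases g0 (fun a => (if ha : ({a} : Finset (Fin n)) ∈ R then X (e ⟨{a}, ha⟩) else 0) - g0)
  have hg_last : g (Fin.last n) = g0 := by simp only [g, Fin.lastCases_last]
  have hg_cast : ∀ a : Fin n, g (Fin.castSucc a) =
      (if ha : ({a} : Finset (Fin n)) ∈ R then X (e ⟨{a}, ha⟩) else 0) - g0 := by
    intro a; simp only [g, Fin.lastCases_castSucc]
  have hnode : ∀ S : Fam R, aeval g (ballEta p n S.1) = X (e S) := by
    intro S
    rcases S.1.eq_empty_or_nonempty with h0 | hne
    · -- `S = ∅`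
      have h0R : (∅ : Finset (Fin n)) ∈ R := h0 ▸ S.2
      have hS : S = ⟨∅, h0R⟩ := Subtype.ext h0
      rw [ballEta, h0, Finset.sum_empty, add_zero, aeval_X, hg_last]
      simp only [g0, dif_pos h0R]
      congr 2; exact hS.symm
    · -- `S = {a}`
      obtain ⟨a, h1⟩ := Finset.card_eq_one.mp (le_antisymm (hR S.1 S.2) (Finset.card_pos.mpr hne))
      have h1R : ({a} : Finset (Fin n)) ∈ R := h1 ▸ S.2
      have hS : S = ⟨{a}, h1R⟩ := Subtype.ext h1
      rw [ballEta, h1, Finset.sum_singleton, map_add, aeval_X, aeval_X, hg_last, hg_cast]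
      simp only [dif_pos h1R]
      have : e ⟨{a}, h1R⟩ = e S := by rw [hS]
      rw [this]; ring
  have hmat : ((aeval g).mapMatrix (colMatrix p n k d R W)).submatrix e.symm e.symm =
      Matrix.of fun i j : Fin N => (X i : MvPolynomial (Fin N) (ZMod p)) ^ ballWt p k d (W (e.symm j)) := by
    refine Matrix.ext fun i j => ?_
    simp only [Matrix.submatrix_apply, AlgHom.mapMatrix_apply, Matrix.map_apply, colMatrix, Matrix.of_apply, map_pow,
      hnode, Equiv.apply_symm_apply]
  intro h0
  apply det_X_pow_ne_zero (R := ZMod p) (fun j : Fin N => ballWt p k d (W (e.symm j)))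
    (fun i j hij => e.symm.injective (hW hij))
  rw [← hmat, Matrix.det_submatrix_equiv_self, ← AlgHom.map_det, h0, map_zero]

/-- **Jointly peelable pair, with the radius-one leaf** (certificate format; see `…JointPeelClass`). -/
inductive JointlyPeelable₂ (k : ℕ) (d : Fin k → ℕ) :
    (n : ℕ) → (R : Finset (Finset (Fin n))) → (Fam R → Finset (Fin k)) → Prop
  | small {n : ℕ} {R : Finset (Finset (Fin n))} {W : Fam R → Finset (Fin k)} (hR : R.card ≤ 1) :
      JointlyPeelable₂ k d n R W
  | radiusOne {n : ℕ} {R : Finset (Finset (Fin n))} {W : Fam R → Finset (Fin k)} (hR : ∀ S ∈ R, S.card ≤ 1)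
      (hW : Function.Injective W) (hd : Function.Injective d) :
      JointlyPeelable₂ k d n R W
  | peel {n : ℕ} {R : Finset (Finset (Fin (n + 1)))} {W : Fam R → Finset (Fin k)} (hR : IsDownClosedFam R)
      (c₀ : Fin k) (hmin : ∀ T, ∀ x ∈ W T, x ≠ c₀ → d c₀ < d x)
      (κ₀ : Fam (famDel R) ≃ {T : Fam R // c₀ ∉ W T}) (κ₁ : Fam (famLink R) ≃ {T : Fam R // c₀ ∈ W T})
      (hdel : JointlyPeelable₂ k d n (famDel R) (fun S => W (κ₀ S).1))
      (hlink : JointlyPeelable₂ k d n (famLink R) (fun S => (W (κ₁ S).1).erase c₀)) :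
      JointlyPeelable₂ k d (n + 1) R W
  | relabel {n : ℕ} {R : Finset (Finset (Fin n))} {W : Fam R → Finset (Fin k)} (π : Equiv.Perm (Fin n))
      (e : Fam R ≃ Fam (R.map (Finset.mapEmbedding π.toEmbedding).toEmbedding))
      (he : ∀ S : Fam R, (e S).1 = S.1.map π.toEmbedding)
      (h : JointlyPeelable₂ k d n (R.map (Finset.mapEmbedding π.toEmbedding).toEmbedding) (fun T => W (e.symm T))) :
      JointlyPeelable₂ k d n R W

/-- Base-`p` weights with an injective digit-exponent map separate digit sets. -/
theorem ballWt_injective (k : ℕ) (d : Fin k → ℕ) (hd : Function.Injective d) :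
    Function.Injective fun T : Finset (Fin k) => ballWt p k d T := by
  classical
  intro T T' hTT'
  have hp : 2 ≤ p := (Fact.out : p.Prime).two_le
  have h1 : ∑ i ∈ T.map ⟨d, hd⟩, p ^ i = ∑ i ∈ T'.map ⟨d, hd⟩, p ^ i := by
    rw [Finset.sum_map, Finset.sum_map]; exact hTT'
  have h2 := Finset.geomSum_injective hp h1
  exact Finset.map_injective ⟨d, hd⟩ h2

/-- **A `JointlyPeelable₂` certificate makes the Moore matrix nonsingular** (every prime `p`). -/
theorem colMatrix_det_ne_zero_of_jointlyPeelable₂ {k : ℕ} {d : Fin k → ℕ} {n : ℕ}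
    {R : Finset (Finset (Fin n))} {W : Fam R → Finset (Fin k)} (hJ : JointlyPeelable₂ k d n R W) :
    (colMatrix p n k d R W).det ≠ 0 := by
  induction hJ with
  | small hR => exact colMatrix_det_ne_zero_of_card_le_one p _ _ _ _ _ hR
  | radiusOne hR hW hd =>
      exact colMatrix_det_ne_zero_of_radius_le_one p _ _ _ _ hR _ ((ballWt_injective p _ _ hd).comp hW)
  | peel hR c₀ hmin κ₀ κ₁ _ _ ihdel ihlink =>
      exact colMatrix_det_ne_zero_peel p _ _ _ _ hR _ c₀ hmin κ₀ κ₁ ihdel ihlink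
  | relabel π e he _ ih => exact colMatrix_det_ne_zero_relabel p _ _ _ _ _ π e he ih

omit [Fact p.Prime] in
/-- **JOINTLY PEELABLE LAYOUTS (radius-one leaves) ARE HIT.** `h ≥ 2`; `u, w : Fin r → Finset (Fin h)`; `σ : Fin r ≃ Fam R`
an enumeration of the row family by `u`; a `JointlyPeelable₂` certificate for (`R`, columns `T ↦ w (σ⁻¹ T)`) with the item's
digit exponents ⇒ the partition minor of `(u, w)` is nonsingular at some `f ∈ SmallCircuits ℂ (h+h) 5`. -/
theorem partitionMinor_hit_of_jointlyPeelable₂ {h r : ℕ} (hh : 2 ≤ h) (u w : Fin r → Finset (Fin h))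
    (R : Finset (Finset (Fin h))) (σ : Fin r ≃ Fam R) (hσ : ∀ i, (σ i).1 = u i)
    (hJ : JointlyPeelable₂ h (fun c : Fin h => (c : ℕ)) h R (fun T => w (σ.symm T))) :
    ∃ f ∈ SmallCircuits ℂ (h + h) 5,
      (Matrix.of fun i j : Fin r => MvPolynomial.coeff
        (∑ a ∈ u i, Finsupp.single (Fin.castAdd h a) 1 +
          ∑ c ∈ w j, Finsupp.single (Fin.natAdd h c) 1) f).det ≠ 0 := by
  classical
  haveI : Fact (Nat.Prime 2) := ⟨Nat.prime_two⟩
  have hC := colMatrix_det_ne_zero_of_jointlyPeelable₂ 2 hJ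
  set ρ : MvPolynomial (Fin (h + 1)) (ZMod 2) →ₐ[ZMod 2] MvPolynomial (Option (Fin h)) (ZMod 2) :=
    rename (finSuccEquivLast : Fin (h + 1) ≃ Option (Fin h)) with hρ
  set N : Matrix (Fin r) (Fin r) (MvPolynomial (Option (Fin h)) (ZMod 2)) :=
    Matrix.of fun i j : Fin r =>
      ((X none + ∑ a ∈ u i, X (some a) : MvPolynomial (Option (Fin h)) (ZMod 2))) ^ (∑ c ∈ w j, 2 ^ (c : ℕ)) with hN
  have hmat : (ρ.mapMatrix (colMatrix 2 h h (fun c : Fin h => (c : ℕ)) R (fun T => w (σ.symm T)))).submatrix σ σ = N := by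
    refine Matrix.ext fun i j => ?_
    simp only [Matrix.submatrix_apply, AlgHom.mapMatrix_apply, Matrix.map_apply, colMatrix, hN, Matrix.of_apply, map_pow,
      ballEta, ballWt, map_add, map_sum, hρ, rename_X, finSuccEquivLast_last, finSuccEquivLast_castSucc, hσ,
      Equiv.symm_apply_apply]
  have hN0 : N.det ≠ 0 := by
    intro h0
    apply hC
    apply MvPolynomial.rename_injective _ (finSuccEquivLast : Fin (h + 1) ≃ Option (Fin h)).injective
    have := ρ.map_det (colMatrix 2 h h (fun c : Fin h => (c : ℕ)) R (fun T => w (σ.symm T)))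
    rw [← Matrix.det_submatrix_equiv_self σ (ρ.mapMatrix (colMatrix 2 h h (fun c : Fin h => (c : ℕ)) R
      (fun T => w (σ.symm T)))), hmat, h0] at this
    rw [map_zero, ← hρ]
    exact this
  exact partitionMinor_hit_of_frobenius_char 2 hh u w hN0

end

end Summit.ValiantsHypothesis.ValiantsHypothesis.Theorems.BarrierLever.FrobeniusDoor
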